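import Literature.Analysis.FluidPDE.DeRosaPertStressErrors
import Literature.Analysis.FluidPDE.FracLaplacianCurl
import Literature.Analysis.FluidPDE.OnsagerBDSVAntidivCurl
import Literature.Analysis.FluidPDE.OnsagerBDSVPotentialTheoryProofs
import Literature.Analysis.FluidPDE.AntidivergenceLinear
import HarnessLib

/-!
# De Rosa's perturbation stage: the dissipative stress `R̊^D_{q+1} = νℛ(-Δ)^γ w_{q+1}`
# (Prop. 5.13) — part 4 of the assembly

L. De Rosa, *Infinitely many Leray–Hopf solutions for the fractional Navier–Stokes equations*,
Comm. PDE 44 (2019) 335–365 = arXiv:1801.10235, §5.5 Prop. 5.13, second half of the proof (p. 17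
of the arXiv text): "To estimate `R̊^D_{q+1}` we first note that `ν < 1` and the two operators
`ℛ` and `(-Δ)^γ` commute, therefore we can first estimate `‖ℛw_{q+1}‖₀` and `‖ℛw_{q+1}‖₁` from
which, using Theorem 7.1 and interpolation in Hölder spaces, we conclude … Finally, combining
(stimawo), (stimawc) and the restriction `γ < 1/3` we get
`‖R̊^D_{q+1}‖₀ ≲ δ_{q+1}^{1/2}λ_{q+1}^{γ-1+α} ≲ δ_{q+1}^{1/2}δ_q^{1/2}λ_q/λ_{q+1}^{1-4α}`", with the
closing remark "it was enough to require `(γ-3α)b < 1-β`".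

This file PROVES part 4 of `DeRosa.perturbationStage_of_parts` (`DeRosa.dissipativePart`:
`‖R̊^D_{q+1}‖₀ ≤ C δ_{q+1}^{1/2}δ_q^{1/2}λ_qλ_{q+1}^{-1+4α}` under the core hypotheses, `0 < γ < β`,
`0 < ν < 1`) by the route the tree's curl form of the perturbation makes natural (same
ingredients as the printed proof — commutation, Thm. 7.1, interpolation between `‖·‖₀` and
`‖·‖₁`, the parameter inequality — with the stationary-phase bound on `ℛw` replaced by the
explicit gain `λ_{q+1}⁻¹` of the curl form): `w_{q+1} = n_{q+1}⁻¹ curl Z` (`BDSV.perturbation`,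
`Z = BDSV.potential`), so that

  `R̊^D_{q+1} = ν n_{q+1}⁻¹ ℛ curl((-Δ)^γ Z)`

(`(-Δ)^γ` commutes with `curl`, `BDSV.curl_fracLaplacian_comm`, and with scalars; `ℛ` is linear),
and `ℛ ∘ curl` is a zero-order operator on Hölder spaces (BDSV §4.4 / App. C Prop. C.1 =
De Rosa Prop. 8.1, `BDSV.holderCZBound.antidivergence_curl_le` with `BDSV.holderCZBound_holds`):

  `‖R̊^D(t)‖₀ ≤ ν n⁻¹ ‖ℛ curl (-Δ)^γ Z(t)‖_{0,α} ≤ ν n⁻¹ C ‖(-Δ)^γ Z(t)‖_{0,α}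
            ≤ ν n⁻¹ C' ‖Z(t)‖_{0,2γ+2α}`                      (Thm. 7.1, `Torus.exists_eContDiffHolderNorm_zero_fracLaplacian_le`)
            `≤ ν n⁻¹ C'' δ_{q+1}^{1/2} n^{2γ+2α}`             (interpolation from `‖Z‖₀ ≲ δ_{q+1}^{1/2}`, `‖∇Z‖₀ ≲ δ_{q+1}^{1/2}λ_{q+1}`,
                                                                `DeRosa.potentialBound_stageFact`)
            `≲ δ_{q+1}^{1/2} λ_{q+1}^{2γ+2α-1} ≤ C δ_{q+1}^{1/2}δ_q^{1/2}λ_qλ_{q+1}^{-1+4α}`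

once `λ_{q+1}^{2γ-2α} ≤ λ_q^{1-β}`, i.e. for `a` large since `(2γ-2α)b < 2βb < 1-β`
(`BDSV.exists_freq_triple_le`) — the parameter inequality of the closing remark (the tree's
`(-Δ)^γ` has symbol `(2π|k|)^{2γ}`).

* `Torus.eHolderNorm_lift_le` — `[lift g]_r ≤ [g]_r` (`proj` is `1`-Lipschitz);
* `DeRosa.dissipativeStress_eq` — the identity `R̊^D = ν n⁻¹ ℛ curl((-Δ)^γ Z)` on `[0,T]`;
* `DeRosa.dissipative_part` — part 4.

## References

* L. De Rosa, Comm. PDE 44 (2019) 335–365 = arXiv:1801.10235, §5.5 Prop. 5.13 (the term R̊^D)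
  and the closing remark, §7 Thm. 7.1, §8 Prop. 8.1. [`Derosa2018`]
* T. Buckmaster, C. De Lellis, L. Székelyhidi Jr., V. Vicol, CPAM 72 (2019) 229–274 =
  arXiv:1701.08678, §4.4 ("`ℛ curl` is a zero-order operator"), §5.3 (5.28), App. C Prop. C.1.
  [`BuckmasterEtAl2018`]
-/

open MeasureTheory Set Filter Function
open scoped NNReal ENNReal ContDiff Matrix Matrix.Norms.Elementwise

noncomputable section

namespace Literature.Analysis.FluidPDE

/-! ## Two generic lemmas -/

namespace Torus

open FunctionSpaces FunctionSpaces.Torus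

variable {d : Type*} [Fintype d]

/-- **The Hölder seminorm of the periodic lift is at most that on the torus**: `[lift g]_r ≤ [g]_r`
(`proj : ℝ^d → T^d` is `1`-Lipschitz, `Torus.HolderWith.lift`). [folklore] -/
theorem eHolderNorm_lift_le {Y : Type*} [NormedAddCommGroup Y] (r : ℝ≥0) (g : UnitAddTorus d → Y) :
    eHolderNorm r (lift g) ≤ eHolderNorm r g := by
  refine le_iInf₂ fun C hC => ?_
  exact (HolderWith.lift hC).eHolderNorm_le

/-- `(-Δ)^α (c • ψ) = c • (-Δ)^α ψ` for a real constant `c` (linearity of the Fourier coefficients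
and of the defining series; a local copy of `Torus.fracLaplacian_const_smul` of
`FractionalNSPrescribedEnergyProlongationProofs`, whose import closure is not wanted here). [folklore] -/
private theorem fracLaplacian_const_smul_local (α c : ℝ) (ψ : UnitAddTorus d → EuclideanSpace ℝ d) :
    fracLaplacian α (c • ψ) = c • fracLaplacian α ψ := by
  funext x
  have hc : (FunctionSpaces.EuclideanSpace.complexify ∘ (c • ψ)) =
      (c : ℂ) • (FunctionSpaces.EuclideanSpace.complexify ∘ ψ) := by
    funext y
    simp only [comp_apply, Pi.smul_apply, LinearIsometry.map_smul]
    exact RCLike.real_smul_eq_coe_smul (K := ℂ) c _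
  rw [fracLaplacian_def, Pi.smul_apply, fracLaplacian_def, hc]
  simp_rw [FunctionSpaces.Torus.mFourierCoeff_const_smul, smul_comm (UnitAddTorus.mFourier _ x) (c : ℂ),
    smul_comm (fracSymbol α _) (c : ℂ)]
  rw [tsum_const_smul'' (c : ℂ)]
  have h : ∀ z : EuclideanSpace ℂ d, FunctionSpaces.EuclideanSpace.realPart ((c : ℂ) • z) =
      c • FunctionSpaces.EuclideanSpace.realPart z := fun z =>
    ContinuousLinearMap.map_smul FunctionSpaces.EuclideanSpace.realPart c z
  exact h _

end Torus

namespace DeRosa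

open BDSV FunctionSpaces FunctionSpaces.Torus

/-- The flat three-torus `𝕋³ = (ℝ/ℤ)³`, local notation. -/
local notation "𝕋³" => UnitAddTorus (Fin 3)

/-- Euclidean `ℝ³`, local notation. -/
local notation "ℝ³" => EuclideanSpace ℝ (Fin 3)

variable {P : Params} {S : Setting} {η : ℕ → ℝ → 𝕋³ → ℝ} {D : ℕ → ℝ → 𝕋³ → ℝ³}

/-- **The dissipative stress through the curl form**: on `[0,T]`,
`R̊^D_{q+1}(t) = (ν n_{q+1}⁻¹) • ℛ curl((-Δ)^γ Z(t))` (`w_{q+1} = n⁻¹ curl Z`, `(-Δ)^γ` commutes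
with scalars and with `curl`, `ℛ` is linear). [cite: Derosa2018, §5.5 Prop. 5.13 (proof: "the two operators ℛ and (-Δ)^γ commute")] -/
theorem dissipativeStress_eq (h : SmoothData P S η D) (𝔚 : MikadoDatum mikadoRadius) {γ : ℝ}
    (hγ : 0 ≤ γ) (ν : ℝ) {t : ℝ} (ht : t ∈ Icc 0 S.T) (x : 𝕋³) :
    (fun j => dissipativeStress P γ ν S 𝔚 η D t x j) =
      (ν * ((P.freqNat (S.q + 1) : ℝ))⁻¹) •
        Torus.antidivergence (BDSV.curl (Torus.fracLaplacian γ (BDSV.potential P S 𝔚 η D t))) x := by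
  set Z := BDSV.potential P S 𝔚 η D t with hZ
  set c : ℝ := ((P.freqNat (S.q + 1) : ℝ))⁻¹ with hc
  have hZs : IsSmooth Z := (h.potential 𝔚).isSmooth_slice ht
  have hU : IsSmooth (Torus.fracLaplacian γ Z) := hZs.fracLaplacian hγ
  have hcU : IsSmooth (BDSV.curl (Torus.fracLaplacian γ Z)) := isSmooth_curl hU
  -- `w(t) = c • curl Z(t)` and `(-Δ)^γ w(t) = c • curl ((-Δ)^γ Z(t))`
  have hw : BDSV.perturbation P S 𝔚 η D t = c • BDSV.curl Z := by
    funext y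
    rfl
  have hcomm : BDSV.curl (Torus.fracLaplacian γ Z) = Torus.fracLaplacian γ (BDSV.curl Z) :=
    funext fun y => curl_fracLaplacian_comm hγ hZs y
  have hL : Torus.fracLaplacian γ (BDSV.perturbation P S 𝔚 η D t) =
      c • BDSV.curl (Torus.fracLaplacian γ Z) := by
    rw [hw, Torus.fracLaplacian_const_smul_local, hcomm]
  have hR : Torus.antidivergence (Torus.fracLaplacian γ (BDSV.perturbation P S 𝔚 η D t)) =
      c • Torus.antidivergence (BDSV.curl (Torus.fracLaplacian γ Z)) := by
    rw [hL, Torus.antidivergence_const_smul hcU c]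
  funext j
  have e : dissipativeStress P γ ν S 𝔚 η D t x j =
      ν • Torus.antidivergence (Torus.fracLaplacian γ (BDSV.perturbation P S 𝔚 η D t)) x j := rfl
  rw [e, hR, Pi.smul_apply, Pi.smul_apply, Pi.smul_apply, smul_smul]

set_option maxHeartbeats 400000 in
/-- **Part 4 of `DeRosa.perturbationStage_of_parts`: the dissipative stress estimate**
(De Rosa Prop. 5.13, the term `R̊^D`): under the core hypotheses, for `0 < γ < β` and `0 < ν < 1`,
`‖R̊^D_{q+1}‖₀ ≤ C δ_{q+1}^{1/2}δ_q^{1/2}λ_qλ_{q+1}^{-1+4α}` (see the module docstring for the chain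
of estimates). [cite: Derosa2018, §5.5 Prop. 5.13 (the term R̊^D) and the closing remark] -/
theorem dissipative_part (𝔚 : MikadoDatum mikadoRadius) (c₀ : ℝ) (hc₀ : 0 < c₀) (Cη : ℕ → ℕ → ℝ) :
    dissipativePart 𝔚 c₀ Cη := by
  intro β hβ hβ3 γ hγ hγβ b hb hbβ
  have hb0 : (0 : ℝ) < b := by linarith
  have hγ1 : γ < 1 := by linarith
  -- the bounds on the potential `Z` (Cor. 5.8 shape), ported under the core hypotheses
  obtain ⟨α₁, hα₁, hZ⟩ := potentialBound_stageFact 𝔚 c₀ hc₀ Cη β hβ hβ3 b hb hbβ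
  -- `α₀`: below `α₁`, below `βb(b-1)` (for `ρ_q > 0`) and with `2γ + 2α < 1`, `α < 1/2`
  have h12γ : 0 < (1 - 2 * γ) / 4 := by linarith
  have hρα : 0 < β * b * (b - 1) := mul_pos (mul_pos hβ hb0) (by linarith)
  refine ⟨min (min α₁ (β * b * (b - 1))) (min ((1 - 2 * γ) / 4) (1 / 2)),
    lt_min (lt_min hα₁ hρα) (lt_min h12γ one_half_pos), ?_⟩
  intro α hα hαlt
  have hαα₁ : α < α₁ := lt_of_lt_of_le hαlt ((min_le_left _ _).trans (min_le_left _ _))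
  have hαρ : α < β * b * (b - 1) := lt_of_lt_of_le hαlt ((min_le_left _ _).trans (min_le_right _ _))
  have hαγ : α < (1 - 2 * γ) / 4 := lt_of_lt_of_le hαlt ((min_le_right _ _).trans (min_le_left _ _))
  have hαh : α < 1 / 2 := lt_of_lt_of_le hαlt ((min_le_right _ _).trans (min_le_right _ _))
  obtain ⟨Nbar, hZ⟩ := hZ α hα hαα₁
  refine ⟨Nbar, fun Cin C₀ => ?_⟩
  obtain ⟨C₁, a₁, ha₁, hZ⟩ := hZ Cin C₀
  -- the exponents `α` and `s = 2γ + 2α` as `ℝ≥0`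
  set αN : ℝ≥0 := ⟨α, hα.le⟩ with hαN
  have hs0 : 0 ≤ 2 * γ + 2 * α := by linarith
  set sN : ℝ≥0 := ⟨2 * γ + 2 * α, hs0⟩ with hsN
  have hαN0 : 0 < αN := by exact_mod_cast hα
  have hαN1 : αN < 1 := by
    show (⟨α, hα.le⟩ : ℝ≥0) < 1
    exact_mod_cast (show α < 1 by linarith)
  have hs : 2 * γ + (αN : ℝ) < sN := by show 2 * γ + α < 2 * γ + 2 * α; linarith
  have hs1 : sN ≤ 1 := by
    show (⟨2 * γ + 2 * α, hs0⟩ : ℝ≥0) ≤ 1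
    exact_mod_cast (show 2 * γ + 2 * α ≤ 1 by linarith)
  -- the Calderón–Zygmund constant of `ℛ ∘ curl` on `C^{0,α}` and the constant of Thm. 7.1
  obtain ⟨Ccz, hCczT, hcz⟩ := holderCZBound_holds.antidivergence_curl_le hαN0 hαN1 0
  obtain ⟨C71, h71⟩ := Torus.exists_eContDiffHolderNorm_zero_fracLaplacian_le (Fin 3) hγ hγ1 hs hs1
  -- thresholds in `a`: `ρ_q > 0` and the parameter inequality `λ_q^{β-1} λ_{q+1}^{2γ-2α} ≤ 1`
  have hαb : α < 2 * β * b * (b - 1) := by nlinarith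
  obtain ⟨a₂, ha₂, hpar2⟩ := exists_threshold_amp_succ_succ hb hαb
  have hE : -(1 - β) + b * (2 * γ - 2 * α) + b ^ 2 * 0 < 0 := by
    have h2βb : 2 * β * b < 1 - β := by
      have := (lt_div_iff₀ (by linarith : (0 : ℝ) < 2 * β)).1 hbβ
      linarith
    nlinarith [mul_pos hγ hb0, mul_pos hα hb0]
  obtain ⟨a₃, ha₃, hpar3⟩ := exists_freq_triple_le hb.le hE 1
  -- the constant
  set K : ℝ := Ccz.toReal * C71 * (61 * (|C₁| + 1)) * (2 * Real.pi) with hK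
  have hK0 : 0 ≤ K := by rw [hK]; positivity
  refine ⟨K, max a₁ (max a₂ a₃), lt_max_of_lt_left ha₁, ?_⟩
  intro a ha ν hν hν1 S H 𝒟 t ht x
  have haa₁ : a₁ ≤ a := (le_max_left _ _).trans ha
  have haa₂ : a₂ ≤ a := ((le_max_left _ _).trans (le_max_right _ _)).trans ha
  have haa₃ : a₃ ≤ a := ((le_max_right _ _).trans (le_max_right _ _)).trans ha
  have ha1 : (1 : ℝ) ≤ a := ha₁.le.trans haa₁
  -- smooth data (`ρ_q > 0` by the threshold `a₂`)
  have hSD : SmoothData (⟨β, α, a, b⟩ : Params) S 𝒟.cut.η 𝒟.D := H.smoothData ha1 (hpar2 a haa₂ S.q) hc₀ 𝒟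
  -- the scales
  have hf1 := freq_pos (b := b) ha1 (S.q + 1)
  have hf0 := freq_pos (b := b) ha1 S.q
  have hδ1 := amp_pos (β := β) (b := b) ha1 (S.q + 1)
  set sδ : ℝ := Real.sqrt (amp β a b (S.q + 1)) with hsδ
  have hsδ0 : 0 ≤ sδ := Real.sqrt_nonneg _
  set n : ℕ := Params.freqNat ⟨β, α, a, b⟩ (S.q + 1) with hn
  have hn1 : (1 : ℝ) ≤ n := by exact_mod_cast Params.freqNat_pos ⟨β, α, a, b⟩ ha1 (S.q + 1)
  have hn0 : (0 : ℝ) < n := by linarith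
  have hfreqn : freq a b (S.q + 1) = 2 * Real.pi * n :=
    Params.freq_eq ⟨β, α, a, b⟩ (by show (0 : ℝ) ≤ a; linarith) (S.q + 1)
  -- ### the bounds on `Z(t)`
  obtain ⟨hZ0, hZ1⟩ := hZ a haa₁ S H 𝒟
  set Z := BDSV.potential ⟨β, α, a, b⟩ S 𝔚 𝒟.cut.η 𝒟.D t with hZdef
  have hZs : IsSmooth Z := (hSD.potential 𝔚).isSmooth_slice ht
  have hM0 : ∀ y, ‖Z y‖ ≤ |C₁| * sδ := fun y =>
    (hZ0 t ht y).trans (mul_le_mul_of_nonneg_right (le_abs_self _) hsδ0)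
  have hM1 : ∀ (i : Fin 3) y, ‖Torus.partialDeriv i Z y‖ ≤ |C₁| * (sδ * freq a b (S.q + 1)) := fun i y =>
    (hZ1 i t ht y).trans (mul_le_mul_of_nonneg_right (le_abs_self _) (mul_nonneg hsδ0 hf1.le))
  -- ### `‖Z(t)‖_{0,s} ≤ 61 |C₁| δ^{1/2} n^s`
  set m₀ : ℝ := |C₁| * sδ with hm₀def
  set m₁ : ℝ := |C₁| * (sδ * freq a b (S.q + 1)) with hm₁def
  have hm₀ : 0 ≤ m₀ := mul_nonneg (abs_nonneg _) hsδ0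
  have hm₁ : 0 ≤ m₁ := mul_nonneg (abs_nonneg _) (mul_nonneg hsδ0 hf1.le)
  have hΛ0 : (0 : ℝ≥0) < (n : ℝ≥0) := by exact_mod_cast Params.freqNat_pos ⟨β, α, a, b⟩ ha1 (S.q + 1)
  have hM0' : ∀ y, ‖Z y‖ ≤ (m₀.toNNReal : ℝ) := fun y =>
    (hM0 y).trans (le_of_eq (Real.coe_toNNReal _ hm₀).symm)
  have hM1' : ∀ (i : Fin 3) y, ‖Torus.partialDeriv i Z y‖ ≤ (m₁.toNNReal : ℝ) := fun i y =>
    (hM1 i y).trans (le_of_eq (Real.coe_toNNReal _ hm₁).symm)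
  have hZ1s : IsContDiff 1 Z := hZs.isContDiff (by exact_mod_cast le_top)
  have hHol := Torus.eHolderNorm_le_of_norm_le_of_norm_partialDeriv_le hZ1s hs1
    (M₀ := m₀.toNNReal) (M₁ := m₁.toNNReal) hΛ0 hM0' hM1'
  -- the real number bounding the interpolation expression
  have hns : (1 : ℝ) ≤ (n : ℝ) ^ (sN : ℝ) := Real.one_le_rpow hn1 (by positivity)
  have hexpr : ((NNReal.sqrt (Fintype.card (Fin 3)) * (Fintype.card (Fin 3) * m₁.toNNReal) *
      (n : ℝ≥0)⁻¹ ^ (1 - sN : ℝ) + 2 * m₀.toNNReal * (n : ℝ≥0) ^ (sN : ℝ) : ℝ≥0) : ℝ) ≤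
        60 * |C₁| * sδ * (n : ℝ) ^ (sN : ℝ) := by
    have hcard : (Fintype.card (Fin 3) : ℝ≥0) = 3 := by simp
    rw [hcard]
    have hE : ((NNReal.sqrt 3 * (3 * m₁.toNNReal) * (n : ℝ≥0)⁻¹ ^ (1 - sN : ℝ) +
        2 * m₀.toNNReal * (n : ℝ≥0) ^ (sN : ℝ) : ℝ≥0) : ℝ) =
        Real.sqrt 3 * (3 * m₁) * ((n : ℝ)⁻¹) ^ (1 - (sN : ℝ)) + 2 * m₀ * (n : ℝ) ^ (sN : ℝ) := by
      rw [NNReal.coe_add, NNReal.coe_mul, NNReal.coe_mul, NNReal.coe_mul, NNReal.coe_mul, NNReal.coe_mul,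
        NNReal.coe_rpow, NNReal.coe_rpow, NNReal.coe_inv, NNReal.coe_natCast, Real.coe_toNNReal _ hm₀,
        Real.coe_toNNReal _ hm₁, Real.coe_sqrt]
      norm_num
    rw [hE]
    have h3 : Real.sqrt 3 ≤ 2 := by
      rw [Real.sqrt_le_left (by norm_num)]; norm_num
    -- `λ_{q+1} n^{-(1-s)} = 2π n^s`
    have hpow : freq a b (S.q + 1) * ((n : ℝ)⁻¹) ^ (1 - (sN : ℝ)) = 2 * Real.pi * (n : ℝ) ^ (sN : ℝ) := by
      rw [hfreqn, Real.inv_rpow hn0.le, ← Real.rpow_neg hn0.le, show -(1 - (sN : ℝ)) = (sN : ℝ) - 1 by ring,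
        Real.rpow_sub hn0, Real.rpow_one]
      field_simp
    have hπ : Real.pi ≤ 4 := Real.pi_le_four
    have hA : Real.sqrt 3 * (3 * m₁) * ((n : ℝ)⁻¹) ^ (1 - (sN : ℝ)) =
        3 * Real.sqrt 3 * (2 * Real.pi) * (|C₁| * sδ * (n : ℝ) ^ (sN : ℝ)) := by
      rw [hm₁def, show Real.sqrt 3 * (3 * (|C₁| * (sδ * freq a b (S.q + 1)))) * ((n : ℝ)⁻¹) ^ (1 - (sN : ℝ)) =
        3 * Real.sqrt 3 * |C₁| * sδ * (freq a b (S.q + 1) * ((n : ℝ)⁻¹) ^ (1 - (sN : ℝ))) by ring, hpow]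
      ring
    rw [hA, hm₀def]
    have hC₁s : 0 ≤ |C₁| * sδ * (n : ℝ) ^ (sN : ℝ) := by positivity
    have h2M : 2 * (|C₁| * sδ) * (n : ℝ) ^ (sN : ℝ) = 2 * (|C₁| * sδ * (n : ℝ) ^ (sN : ℝ)) := by ring
    rw [h2M]
    have hsq3 : 0 ≤ Real.sqrt 3 := Real.sqrt_nonneg 3
    have hprod : Real.sqrt 3 * Real.pi ≤ 8 := by
      nlinarith [mul_nonneg (sub_nonneg.2 h3) Real.pi_pos.le, mul_nonneg (sub_nonneg.2 hπ) hsq3]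
    calc 3 * Real.sqrt 3 * (2 * Real.pi) * (|C₁| * sδ * (n : ℝ) ^ (sN : ℝ)) + 2 * (|C₁| * sδ * (n : ℝ) ^ (sN : ℝ))
        = (6 * (Real.sqrt 3 * Real.pi) + 2) * (|C₁| * sδ * (n : ℝ) ^ (sN : ℝ)) := by ring
      _ ≤ (6 * 8 + 2) * (|C₁| * sδ * (n : ℝ) ^ (sN : ℝ)) :=
          mul_le_mul_of_nonneg_right (add_le_add (mul_le_mul_of_nonneg_left hprod (by norm_num)) le_rfl) hC₁s
      _ ≤ 60 * (|C₁| * sδ * (n : ℝ) ^ (sN : ℝ)) := mul_le_mul_of_nonneg_right (by norm_num) hC₁s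
      _ = 60 * |C₁| * sδ * (n : ℝ) ^ (sN : ℝ) := by ring
  have hZnorm : Torus.eContDiffHolderNorm 0 sN Z ≤ ENNReal.ofReal (61 * |C₁| * sδ * (n : ℝ) ^ (sN : ℝ)) := by
    have hsplit : Torus.eContDiffHolderNorm 0 sN Z = eSupNorm Z + eHolderNorm sN (lift Z) := by
      rw [Torus.eContDiffHolderNorm, eContDiffHolderNorm_zero_eq, eSupNorm_lift]
    rw [hsplit]
    have h1 : eSupNorm Z ≤ ENNReal.ofReal (|C₁| * sδ * (n : ℝ) ^ (sN : ℝ)) :=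
      (eSupNorm_le_ofReal hM0).trans (ENNReal.ofReal_le_ofReal
        (le_mul_of_one_le_right (mul_nonneg (abs_nonneg _) hsδ0) hns))
    have h2 : eHolderNorm sN (lift Z) ≤ ENNReal.ofReal (60 * |C₁| * sδ * (n : ℝ) ^ (sN : ℝ)) := by
      refine (Torus.eHolderNorm_lift_le sN Z).trans (hHol.trans ?_)
      rw [← ENNReal.ofReal_coe_nnreal]
      exact ENNReal.ofReal_le_ofReal hexpr
    calc eSupNorm Z + eHolderNorm sN (lift Z)
        ≤ ENNReal.ofReal (|C₁| * sδ * (n : ℝ) ^ (sN : ℝ)) + ENNReal.ofReal (60 * |C₁| * sδ * (n : ℝ) ^ (sN : ℝ)) :=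
          add_le_add h1 h2
      _ = ENNReal.ofReal (61 * |C₁| * sδ * (n : ℝ) ^ (sN : ℝ)) := by
          rw [← ENNReal.ofReal_add (by positivity) (by positivity)]
          ring_nf
  -- ### `‖ℛ curl (-Δ)^γ Z(t)‖_{0,α} ≤ Ccz C71 (61|C₁| δ^{1/2} n^s)`
  set U := Torus.fracLaplacian γ Z with hUdef
  have hU : IsSmooth U := hZs.fracLaplacian hγ.le
  have hRU : Torus.eContDiffHolderNorm 0 αN (fun y => Torus.antidivergence (BDSV.curl U) y) ≤
      Ccz * (C71 * ENNReal.ofReal (61 * |C₁| * sδ * (n : ℝ) ^ (sN : ℝ))) :=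
    (hcz U hU).trans (mul_le_mul' le_rfl ((h71 hZs).trans (mul_le_mul' le_rfl hZnorm)))
  -- in real numbers
  set B : ℝ := Ccz.toReal * C71 * (61 * |C₁| * sδ * (n : ℝ) ^ (sN : ℝ)) with hB
  have hB0 : 0 ≤ B := by rw [hB]; positivity
  have hRUreal : ∀ y, ‖Torus.antidivergence (BDSV.curl U) y‖ ≤ B := by
    intro y
    have h1 : ‖Torus.antidivergence (BDSV.curl U) y‖ₑ ≤ Ccz * (C71 * ENNReal.ofReal (61 * |C₁| * sδ * (n : ℝ) ^ (sN : ℝ))) :=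
      ((enorm_le_eSupNorm _ y).trans (Torus.eSupNorm_le_eContDiffHolderNorm 0 αN _)).trans hRU
    have h2 : (Ccz * (C71 * ENNReal.ofReal (61 * |C₁| * sδ * (n : ℝ) ^ (sN : ℝ)))) = ENNReal.ofReal B := by
      rw [hB, mul_assoc (Ccz.toReal) (C71 : ℝ), ENNReal.ofReal_mul ENNReal.toReal_nonneg,
        ENNReal.ofReal_toReal hCczT, ENNReal.ofReal_mul C71.coe_nonneg, ENNReal.ofReal_coe_nnreal]
    rw [h2] at h1
    rwa [← ofReal_norm, ENNReal.ofReal_le_ofReal_iff hB0] at h1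
  -- ### the pointwise bound on `R̊^D(t, x)`
  have hid := dissipativeStress_eq hSD 𝔚 hγ.le ν ht x
  have hnorm : ‖(fun j => dissipativeStress ⟨β, α, a, b⟩ γ ν S 𝔚 𝒟.cut.η 𝒟.D t x j)‖ ≤ ν * (n : ℝ)⁻¹ * B := by
    rw [hid, norm_smul, Real.norm_eq_abs, abs_of_nonneg (mul_nonneg hν.le (inv_nonneg.2 hn0.le))]
    exact mul_le_mul_of_nonneg_left (hRUreal x) (mul_nonneg hν.le (inv_nonneg.2 hn0.le))
  refine hnorm.trans ?_
  -- ### the parameter inequality: `ν n⁻¹ B ≤ K δ_{q+1}^{1/2} δ_q^{1/2} λ_q λ_{q+1}^{-1+4α}`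
  -- `n^{s-1} ≤ 2π λ_{q+1}^{s-1}` and `λ_{q+1}^{2γ-2α} ≤ λ_q^{1-β}`
  have hkey := hpar3 a haa₃ S.q
  rw [Real.rpow_zero, mul_one, one_mul] at hkey
  -- `λ_q^{-(1-β)} λ_{q+1}^{2γ-2α} ≤ 1`
  have hsqamp : Real.sqrt (amp β a b S.q) * freq a b S.q = freq a b S.q ^ (1 - β) := by
    rw [sqrt_amp ha1, ← Real.rpow_add_one (freq_pos ha1 _).ne']
    ring_nf
  have hn_rpow : (n : ℝ)⁻¹ * (n : ℝ) ^ (sN : ℝ) ≤ 2 * Real.pi * freq a b (S.q + 1) ^ ((sN : ℝ) - 1) := by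
    -- `n^{s-1} = (λ/(2π))^{s-1} = (2π)^{1-s} λ^{s-1} ≤ 2π λ^{s-1}`
    have e1 : (n : ℝ)⁻¹ * (n : ℝ) ^ (sN : ℝ) = (n : ℝ) ^ ((sN : ℝ) - 1) := by
      rw [Real.rpow_sub_one hn0.ne', div_eq_mul_inv, mul_comm]
    have e2 : (n : ℝ) = freq a b (S.q + 1) / (2 * Real.pi) := by
      rw [hfreqn]; field_simp
    rw [e1, e2, Real.div_rpow hf1.le (by positivity), div_eq_mul_inv, mul_comm]
    refine mul_le_mul_of_nonneg_right ?_ (Real.rpow_nonneg hf1.le _)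
    rw [← Real.rpow_neg (by positivity), show -((sN : ℝ) - 1) = 1 - (sN : ℝ) by ring]
    calc (2 * Real.pi) ^ (1 - (sN : ℝ)) ≤ (2 * Real.pi) ^ (1 : ℝ) :=
          Real.rpow_le_rpow_of_exponent_le (by linarith [Real.pi_gt_three]) (by
            have : (0 : ℝ) ≤ sN := sN.coe_nonneg
            linarith)
      _ = 2 * Real.pi := Real.rpow_one _
  have hfreqpow : freq a b (S.q + 1) ^ ((sN : ℝ) - 1) ≤
      Real.sqrt (amp β a b S.q) * freq a b S.q * freq a b (S.q + 1) ^ (-1 + 4 * α) := by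
    rw [hsqamp]
    -- `λ_{q+1}^{s-1} = λ_{q+1}^{2γ-2α} λ_{q+1}^{-1+4α}` and `λ_{q+1}^{2γ-2α} ≤ λ_q^{1-β}`
    have e1 : freq a b (S.q + 1) ^ ((sN : ℝ) - 1) =
        freq a b (S.q + 1) ^ (2 * γ - 2 * α) * freq a b (S.q + 1) ^ (-1 + 4 * α) := by
      rw [← Real.rpow_add hf1]
      congr 1
      show 2 * γ + 2 * α - 1 = 2 * γ - 2 * α + (-1 + 4 * α)
      ring
    rw [e1]
    refine mul_le_mul_of_nonneg_right ?_ (Real.rpow_nonneg hf1.le _)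
    have h0 : 0 < freq a b S.q ^ (-(1 - β)) := Real.rpow_pos_of_pos hf0 _
    have hmul := mul_le_mul_of_nonneg_left hkey (Real.rpow_nonneg hf0.le (1 - β))
    rw [mul_one, ← mul_assoc, ← Real.rpow_add hf0, show 1 - β + -(1 - β) = 0 by ring, Real.rpow_zero,
      one_mul] at hmul
    exact hmul
  have hW0 : 0 ≤ (n : ℝ)⁻¹ * (n : ℝ) ^ (sN : ℝ) := mul_nonneg (inv_nonneg.2 hn0.le) (Real.rpow_nonneg hn0.le _)
  have hA0 : 0 ≤ Ccz.toReal * C71 * 61 := by positivity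
  have hA1 : 0 ≤ 1 * (Ccz.toReal * C71 * 61 * (|C₁| + 1)) * sδ :=
    mul_nonneg (mul_nonneg zero_le_one (mul_nonneg hA0 (by positivity))) hsδ0
  have hscale0 : 0 ≤ Real.sqrt (amp β a b S.q) * freq a b S.q * freq a b (S.q + 1) ^ (-1 + 4 * α) :=
    mul_nonneg (mul_nonneg (Real.sqrt_nonneg _) hf0.le) (Real.rpow_nonneg hf1.le _)
  calc ν * (n : ℝ)⁻¹ * B
      = (ν * (Ccz.toReal * C71 * 61 * |C₁|) * sδ) * ((n : ℝ)⁻¹ * (n : ℝ) ^ (sN : ℝ)) := by rw [hB]; ring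
    _ ≤ (1 * (Ccz.toReal * C71 * 61 * (|C₁| + 1)) * sδ) * (2 * Real.pi * freq a b (S.q + 1) ^ ((sN : ℝ) - 1)) := by
        refine mul_le_mul ?_ hn_rpow hW0 hA1
        refine mul_le_mul_of_nonneg_right ?_ hsδ0
        refine mul_le_mul hν1.le ?_ (mul_nonneg hA0 (abs_nonneg _)) zero_le_one
        exact mul_le_mul_of_nonneg_left (by linarith [abs_nonneg C₁]) hA0
    _ ≤ (1 * (Ccz.toReal * C71 * 61 * (|C₁| + 1)) * sδ) * (2 * Real.pi *
          (Real.sqrt (amp β a b S.q) * freq a b S.q * freq a b (S.q + 1) ^ (-1 + 4 * α))) := by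
        refine mul_le_mul_of_nonneg_left ?_ hA1
        exact mul_le_mul_of_nonneg_left hfreqpow (by positivity)
    _ = K * (Real.sqrt (amp β a b (S.q + 1)) * Real.sqrt (amp β a b S.q) * freq a b S.q *
          freq a b (S.q + 1) ^ (-1 + 4 * α)) := by rw [hK, hsδ]; ring

end DeRosa

end Literature.Analysis.FluidPDE
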